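import Summits.ResolutionOfSingularities.ResolutionOfSingularities.Theorems.PurelyInseparableDim4ResConeLSectorKill
import HarnessLib
import HarnessLib.Audit.Tags

/-!
# Purely inseparable four-folds — THE L-SECTOR ROTATION KILLS: the three remaining two-step deaths
# (cell `res-dim4-pi`, K2(p) lane, slice B, brick K24a-R2b)

[OURS · counted 0 · cell `res-dim4-pi` · K2(p) lane holder res-dim4-p-12 g3's brick by signature (bus 2026-08-29
03:55Z), template = the holder's `…ResConeLSectorKill` (K24a-R2, p693743); seat res-dim4-p-9 g3.]  Nothing here
proves K2(p)/K2(5), `NoIsolatedTrap p p` or resolution of singularities in dimension ≥ 4 / characteristic `p`.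

Two-slot `A∞` tail of the light regime (`p = 5`, `d = 3`, boundary `x_A x_B x_ν` of weights `1`, `ν` idle, `f`
free), L-sector (the vertex form does not charge the free letter).  `…LSectorKill` killed the letter change
«slot `A` then slot `B`» (case (i)).  Besides SLOT steps (chart `A` or `B`, translation along `f`) the tail has
ROTATIONS (chart `f`, translation `τ e_B` «losing `B`» or `τ e_A` «losing `A`»: the free letter becomes
exceptional, the lost one free).  This file kills the three remaining two-step patterns with the SAME COUNT
`T_• = E_• + E_ν + |E| − 5 ≥ 5` over the one source lemma `exists_source_of_mem_support_step_single`: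
* (ii) slot `A` (`β e_f`) then rotation chart `f` losing `B` (`τ e_B`): `5 ≤ T_A + T_f + T_ν`
  (`five_le_after_rotation`; middle-state hypotheses = the template's `hone`/`hsix`, i.e. `ℓ₁ B = ℓ₁ f = 0`);
* (iii) rotation chart `f` losing `A` (`τ e_A`; `ℓ₀ A = ℓ₀ B = ℓ₀ f = 0`, cone₀ `= c·x_ν³`) then slot `B` along the
  new free letter `A` (`β′ e_A`; `ℓ₁ A = ℓ₁ B = 0`): `5 ≤ T_f + T_B + T_ν`;
* (iv) rotation chart `f` losing `A` then rotation chart `A` losing `B` (`τ′ e_B`): `5 ≤ T_f + T_A + T_ν` —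
  (iii) and (iv) are ONE lemma `five_le_after_step_from_rotated` (second chart `κ`, translation letter `t`,
  `{κ, t} ∩ {f, ν} = ∅`).
In each case `5 ≤ ord_{(three boundary letters)} F` at the third state, whose free axis refutes isolation
(`not_isIsolated_of_forall_five_le`); cone dresses read the exponent hypotheses off the residual power cones as
in the template.  NOT killed here (the genuine L-residual, holder 03:55Z): slot `κ` → slot `κ`, slot `κ` → rotation
losing `κ`, rotation (chart `φ`) → slot `φ`, rotation (chart `φ`) → rotation losing `φ`.

bears_on: LADDER-RESOLUTION:D157-DOOR2 (res-dim4-pi · K2(p) · slice B · K24a-R2b L-sector rotations).  Supports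
stmt-ResolutionOfSingularities-16155 (helper).
-/

set_option linter.dupNamespace false -- mandated namespace of this single-conjunct summit

namespace Summit.ResolutionOfSingularities.ResolutionOfSingularities.Theorems.PIDim4

namespace ResCone

open MvPolynomial Finset
open Literature.AlgebraicGeometry.Resolution
open Literature.AlgebraicGeometry.Resolution.CentreBlowup
open Literature.AlgebraicGeometry.Resolution.Hauser2010
open Literature.AlgebraicGeometry.Resolution.HauserPerlega2019

variable {K : Type} [Field K] [DecidableEq K]

/-! ## 1. Case (ii): slot `A`, then the rotation chart `f` losing `B` -/

/-- **STEP 2 of (ii): rotation chart `f` with translation `τ e_B`.**  From a state whose monomials have degree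
`≥ 6` and `A`-, `ν`-exponents `≥ 1`, whose monomials with `A`-exponent `1` have degree `6` and whose degree-`6`
monomials have `A`- plus `ν`-exponent `≥ 4` (the template's middle state), the `x_f`-chart with translation `τ e_B`
(`p = q = 5`) gives a polynomial all of whose monomials have `(A, f, ν)`-degree `≥ 5`. [OURS] [folklore] -/
theorem five_le_after_rotation {A B ν f : Fin 4} (hAB : A ≠ B) (hAf : A ≠ f) (hBν : B ≠ ν) (hBf : B ≠ f)
    (hνf : ν ≠ f) (s₁ : State K) (τ : K) (hq : ((5 : ℕ) : ℕ∞) ≤ ordAlong Finset.univ s₁.F)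
    (h6 : ∀ E ∈ s₁.F.support, 6 ≤ E.degree) (hbd : ∀ E ∈ s₁.F.support, 1 ≤ E A ∧ 1 ≤ E ν)
    (hone : ∀ E ∈ s₁.F.support, E A = 1 → E.degree = 6)
    (hsix : ∀ E ∈ s₁.F.support, E.degree = 6 → 4 ≤ E A + E ν) {s₂ : State K}
    (hs₂ : s₂ = CentreBlowup.step 5 Finset.univ f (Pi.single B τ) s₁) :
    ∀ T ∈ s₂.F.support, 5 ≤ T A + T f + T ν := by
  subst hs₂
  intro T hT
  obtain ⟨E, hE, hj, -, hi⟩ := exists_source_of_mem_support_step_single 5 hBf.symm τ s₁ hq hT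
  have h6E := h6 E hE
  obtain ⟨hA, hν⟩ := hbd E hE
  rw [hj, hi A hAf hAB, hi ν hνf hBν.symm]
  by_cases hEA : E A = 1
  · have h := hsix E hE (hone E hE hEA)
    omega
  · by_cases hdeg : E.degree = 6
    · have h := hsix E hE hdeg
      omega
    · omega

/-- **(ii) SLOT `A` THEN ROTATION LOSING `B` IS FATAL (exponent dress).** Boundary `x_A x_B x_ν`, orders `6`
(`p = q = 5`, `d = 3`): if the degree-`6` monomials of `F₀` have `A`-exponent `1` and no `x_f` (cone in `K[x_B, x_ν]`:
L-sector and the direction of the `A`-step) and the degree-`6` monomials of `F₁` have `A`- plus `ν`-exponent `≥ 4`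
(cone in `K[x_A, x_ν]`: `ℓ₁ B = ℓ₁ f = 0`, the direction equation `ℓ₁ f + τ ℓ₁ B = 0` of the rotation with
`τ ≠ 0` in the L-sector), then after slot `A` (translation `β e_f`) and the rotation chart `f` (translation `τ e_B`)
the state is NOT an isolated `5`-fold point. [OURS] [folklore] -/
theorem not_isIsolated_after_slot_rotation {A B ν f : Fin 4} (hAB : A ≠ B) (hAν : A ≠ ν) (hAf : A ≠ f)
    (hBν : B ≠ ν) (hBf : B ≠ f) (hνf : ν ≠ f) (s₀ : State K) (β τ : K)
    (hq₀ : ((5 : ℕ) : ℕ∞) ≤ ordAlong Finset.univ s₀.F) (h6₀ : ∀ D ∈ s₀.F.support, 6 ≤ D.degree)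
    (hbd₀ : ∀ D ∈ s₀.F.support, 1 ≤ D B ∧ 1 ≤ D ν)
    (hcone₀ : ∀ D ∈ s₀.F.support, D.degree = 6 → D A = 1 ∧ D f = 0)
    {s₁ : State K} (hs₁ : s₁ = CentreBlowup.step 5 Finset.univ A (Pi.single f β) s₀)
    (hq₁ : ((5 : ℕ) : ℕ∞) ≤ ordAlong Finset.univ s₁.F) (h6₁ : ∀ E ∈ s₁.F.support, 6 ≤ E.degree)
    (hcone₁ : ∀ E ∈ s₁.F.support, E.degree = 6 → 4 ≤ E A + E ν)
    {s₂ : State K} (hs₂ : s₂ = CentreBlowup.step 5 Finset.univ f (Pi.single B τ) s₁) :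
    ¬ IsIsolated 5 s₂.F := by
  obtain ⟨hbd₁, hone⟩ := exponents_after_slot_step_A hAB hAν hAf hBν hBf hνf s₀ β hq₀ h6₀ hbd₀ hcone₀ hs₁
  exact not_isIsolated_of_forall_five_le (A := A) (B := f) (ν := ν) (f := B) hAf hAν hAB hνf.symm hBf.symm
    hBν.symm (five_le_after_rotation hAB hAf hBν hBf hνf s₁ τ hq₁ h6₁
      (fun E hE => ⟨(hbd₁ E hE).1, (hbd₁ E hE).2.2⟩) hone hcone₁ hs₂)

/-- **(ii), cone dress.**  At `s₀` the residual cone is `a₀ (Σ ℓ₀ᵢ xᵢ)^3` with `ℓ₀ A = 0` (direction of the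
`A`-step) and `ℓ₀ f = 0` (L-sector); at `s₁` it is `a₁ (Σ ℓ₁ᵢ xᵢ)^3` with `ℓ₁ B = 0` and `ℓ₁ f = 0` (direction of
the rotation in the L-sector); boundary `e_A + e_B + e_ν` and order `6` at both; then slot `A` followed by the
rotation chart `f` losing `B` ends at a non-isolated state. [OURS] [folklore] -/
theorem not_isIsolated_after_slot_rotation_of_forms {A B ν f : Fin 4} (hAB : A ≠ B) (hAν : A ≠ ν)
    (hAf : A ≠ f) (hBν : B ≠ ν) (hBf : B ≠ f) (hνf : ν ≠ f) (s₀ : State K) (β τ : K)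
    (ho₀ : ordZero s₀.F = 6) (hr₀ : ∀ d ∈ s₀.F.support, s₀.r ≤ d)
    (hrABν₀ : s₀.r = Finsupp.single A 1 + Finsupp.single B 1 + Finsupp.single ν 1)
    {a₀ : K} {ℓ₀ : Fin 4 → K} (hform₀ : resForm s₀ = C a₀ * (∑ i, C (ℓ₀ i) * X i) ^ 3)
    (hℓ₀A : ℓ₀ A = 0) (hℓ₀f : ℓ₀ f = 0)
    {s₁ : State K} (hs₁ : s₁ = CentreBlowup.step 5 Finset.univ A (Pi.single f β) s₀)
    (ho₁ : ordZero s₁.F = 6) (hr₁ : ∀ d ∈ s₁.F.support, s₁.r ≤ d)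
    (hrABν₁ : s₁.r = Finsupp.single A 1 + Finsupp.single B 1 + Finsupp.single ν 1)
    {a₁ : K} {ℓ₁ : Fin 4 → K} (hform₁ : resForm s₁ = C a₁ * (∑ i, C (ℓ₁ i) * X i) ^ 3)
    (hℓ₁B : ℓ₁ B = 0) (hℓ₁f : ℓ₁ f = 0)
    {s₂ : State K} (hs₂ : s₂ = CentreBlowup.step 5 Finset.univ f (Pi.single B τ) s₁) :
    ¬ IsIsolated 5 s₂.F := by
  have hq₀ : ((5 : ℕ) : ℕ∞) ≤ ordAlong Finset.univ s₀.F := by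
    refine le_ordAlong_iff.mpr fun d hd => ?_
    rw [degIn_univ]
    exact_mod_cast le_trans (by norm_num) (le_degree_of_mem_support_of_ordZero ho₀ hd)
  have hq₁ : ((5 : ℕ) : ℕ∞) ≤ ordAlong Finset.univ s₁.F := by
    refine le_ordAlong_iff.mpr fun d hd => ?_
    rw [degIn_univ]
    exact_mod_cast le_trans (by norm_num) (le_degree_of_mem_support_of_ordZero ho₁ hd)
  have hq := triple_apply hAB hAν hAf hBν hBf hνf
  refine not_isIsolated_after_slot_rotation hAB hAν hAf hBν hBf hνf s₀ β τ hq₀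
    (fun D hD => le_degree_of_mem_support_of_ordZero ho₀ hD) (fun D hD => ?_)
    (cone_exponents_first hAB hAν hAf hBν hBf hνf ho₀ hr₀ hrABν₀ fun μ hμ =>
      ⟨apply_eq_zero_of_mem_support_C_mul_linearForm_pow hℓ₀A (hform₀ ▸ hμ),
        apply_eq_zero_of_mem_support_C_mul_linearForm_pow hℓ₀f (hform₀ ▸ hμ)⟩)
    hs₁ hq₁ (fun E hE => le_degree_of_mem_support_of_ordZero ho₁ hE) (fun E hE hdeg => ?_) hs₂
  · have h := hr₀ D hD
    have hB := h B
    have hν := h ν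
    rw [hrABν₀, hq.2.1] at hB
    rw [hrABν₀, hq.2.2.1] at hν
    exact ⟨hB, hν⟩
  · have h := cone_exponents_second hAB hAν hAf hBν hBf hνf ho₁ hr₁ hrABν₁ (fun μ hμ =>
      ⟨apply_eq_zero_of_mem_support_C_mul_linearForm_pow hℓ₁B (hform₁ ▸ hμ),
        apply_eq_zero_of_mem_support_C_mul_linearForm_pow hℓ₁f (hform₁ ▸ hμ)⟩) E hE hdeg
    omega

/-! ## 2. Cases (iii)/(iv): the rotation chart `f` losing `A`, then a chart `κ ∈ {A, B}` -/

/-- **STEP 1 of (iii)/(iv): rotation chart `f` with translation `τ e_A`.**  From a state whose monomials have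
degree `≥ 6`, lie above `x_B x_ν`, and whose degree-`6` monomials have `ν`-exponent `4` (cone `c·x_ν³` on the
boundary `x_A x_B x_ν`), the `x_f`-chart with translation `τ e_A` (`p = q = 5`) gives a state whose monomials lie
above `x_f x_B x_ν` and whose monomials with `f`-exponent `1` have `ν`-exponent `4`. [OURS] [folklore] -/
theorem exponents_after_rotation {A B ν f : Fin 4} (hAB : A ≠ B) (hAν : A ≠ ν) (hAf : A ≠ f)
    (hBf : B ≠ f) (hνf : ν ≠ f) (s : State K) (τ : K) (hq : ((5 : ℕ) : ℕ∞) ≤ ordAlong Finset.univ s.F)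
    (h6 : ∀ D ∈ s.F.support, 6 ≤ D.degree) (hbd : ∀ D ∈ s.F.support, 1 ≤ D B ∧ 1 ≤ D ν)
    (hcone : ∀ D ∈ s.F.support, D.degree = 6 → D ν = 4) {s₁ : State K}
    (hs₁ : s₁ = CentreBlowup.step 5 Finset.univ f (Pi.single A τ) s) :
    (∀ E ∈ s₁.F.support, 1 ≤ E f ∧ 1 ≤ E B ∧ 1 ≤ E ν) ∧ (∀ E ∈ s₁.F.support, E f = 1 → E ν = 4) := by
  subst hs₁
  have hAB' := hAB; have hAν' := hAν
  refine ⟨fun E hE => ?_, fun E hE hEf => ?_⟩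
  · obtain ⟨m, hm, hj, -, hi⟩ := exists_source_of_mem_support_step_single 5 hAf.symm τ s hq hE
    have h6m := h6 m hm
    obtain ⟨hB, hν⟩ := hbd m hm
    rw [hj, hi B hBf hAB'.symm, hi ν hνf hAν'.symm]
    exact ⟨by omega, hB, hν⟩
  · obtain ⟨m, hm, hj, -, hi⟩ := exists_source_of_mem_support_step_single 5 hAf.symm τ s hq hE
    have h6m := h6 m hm
    have hmdeg : m.degree = 6 := by omega
    rw [hi ν hνf hAν'.symm]
    exact hcone m hm hmdeg

/-- **STEP 2 of (iii)/(iv): chart `κ` with translation `γ e_t`, `{κ, t}` disjoint from `{f, ν}`.**  From a state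
whose monomials have degree `≥ 6` and `f`-, `ν`-exponents `≥ 1`, whose monomials with `f`-exponent `1` have
`ν`-exponent `≥ 2` and whose degree-`6` monomials have `f`- plus `ν`-exponent `≥ 4`, the `x_κ`-chart with
translation `γ e_t` (`p = q = 5`) gives a polynomial all of whose monomials have `(f, κ, ν)`-degree `≥ 5`.
(iii): `(κ, t) = (B, A)` — slot `B` along the new free letter `A`; (iv): `(κ, t) = (A, B)` — rotation chart `A`
losing `B`. [OURS] [folklore] -/
theorem five_le_after_step_from_rotated {ν f κ t : Fin 4} (hκt : κ ≠ t) (hκf : κ ≠ f) (hκν : κ ≠ ν)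
    (htf : t ≠ f) (htν : t ≠ ν) (s₁ : State K) (γ : K) (hq : ((5 : ℕ) : ℕ∞) ≤ ordAlong Finset.univ s₁.F)
    (h6 : ∀ E ∈ s₁.F.support, 6 ≤ E.degree) (hbd : ∀ E ∈ s₁.F.support, 1 ≤ E f ∧ 1 ≤ E ν)
    (hone : ∀ E ∈ s₁.F.support, E f = 1 → 2 ≤ E ν)
    (hsix : ∀ E ∈ s₁.F.support, E.degree = 6 → 4 ≤ E f + E ν) {s₂ : State K}
    (hs₂ : s₂ = CentreBlowup.step 5 Finset.univ κ (Pi.single t γ) s₁) :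
    ∀ T ∈ s₂.F.support, 5 ≤ T f + T κ + T ν := by
  subst hs₂
  intro T hT
  obtain ⟨E, hE, hj, -, hi⟩ := exists_source_of_mem_support_step_single 5 hκt γ s₁ hq hT
  have h6E := h6 E hE
  obtain ⟨hf, hν⟩ := hbd E hE
  rw [hj, hi f hκf.symm htf.symm, hi ν hκν.symm htν.symm]
  by_cases hdeg : E.degree = 6
  · have h := hsix E hE hdeg
    omega
  · by_cases hEf : E f = 1
    · have h := hone E hE hEf
      omega
    · omega

/-- **(iii)/(iv) ROTATION LOSING `A`, THEN CHART `κ ∈ {A, B}`, IS FATAL (exponent dress).**  Boundary `x_A x_B x_ν`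
at `s₀` with the degree-`6` monomials equal to `x^r·x_ν³` up to scalars (`ν`-exponent `4`: cone `c·x_ν³`, i.e.
`ℓ₀ A = ℓ₀ B = ℓ₀ f = 0`); rotation chart `f` with translation `τ e_A`; at `s₁` (order `6` kept) the degree-`6`
monomials have `f`- plus `ν`-exponent `≥ 4` (cone in `K[x_f, x_ν]`: `ℓ₁ A = ℓ₁ B = 0`); then any chart `κ` with
translation along `t`, `{κ, t} = {A, B}` or merely disjoint from `{f, ν}`: the third state is NOT an isolated
`5`-fold point (its `x_t`-axis is `5`-fold inside `5 ≤ ord_{(x_f, x_κ, x_ν)}`). [OURS] [folklore] -/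
theorem not_isIsolated_after_rotation_step {A B ν f κ t : Fin 4} (hAB : A ≠ B) (hAν : A ≠ ν) (hAf : A ≠ f)
    (hBf : B ≠ f) (hνf : ν ≠ f) (hκt : κ ≠ t) (hκf : κ ≠ f) (hκν : κ ≠ ν) (htf : t ≠ f)
    (htν : t ≠ ν) (s₀ : State K) (τ γ : K)
    (hq₀ : ((5 : ℕ) : ℕ∞) ≤ ordAlong Finset.univ s₀.F) (h6₀ : ∀ D ∈ s₀.F.support, 6 ≤ D.degree)
    (hbd₀ : ∀ D ∈ s₀.F.support, 1 ≤ D B ∧ 1 ≤ D ν)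
    (hcone₀ : ∀ D ∈ s₀.F.support, D.degree = 6 → D ν = 4)
    {s₁ : State K} (hs₁ : s₁ = CentreBlowup.step 5 Finset.univ f (Pi.single A τ) s₀)
    (hq₁ : ((5 : ℕ) : ℕ∞) ≤ ordAlong Finset.univ s₁.F) (h6₁ : ∀ E ∈ s₁.F.support, 6 ≤ E.degree)
    (hcone₁ : ∀ E ∈ s₁.F.support, E.degree = 6 → 4 ≤ E f + E ν)
    {s₂ : State K} (hs₂ : s₂ = CentreBlowup.step 5 Finset.univ κ (Pi.single t γ) s₁) :
    ¬ IsIsolated 5 s₂.F := by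
  obtain ⟨hbd₁, hone⟩ := exponents_after_rotation hAB hAν hAf hBf hνf s₀ τ hq₀ h6₀ hbd₀ hcone₀ hs₁
  exact not_isIsolated_of_forall_five_le (A := f) (B := κ) (ν := ν) (f := t) hκf.symm hνf.symm htf.symm hκν hκt
    htν.symm (five_le_after_step_from_rotated hκt hκf hκν htf htν s₁ γ hq₁ h6₁
      (fun E hE => ⟨(hbd₁ E hE).1, (hbd₁ E hE).2.2⟩) (fun E hE hEf => by have := hone E hE hEf; omega)
      hcone₁ hs₂)

omit [DecidableEq K] in
/-- **Cone exponents for the cone `c·x_ν³`**: boundary `e_A + e_B + e_ν`, residual cone avoiding `x_A`, `x_B`,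
`x_f` ⇒ every monomial of degree `ord₀ F = 6` has `ν`-exponent `4`. [OURS · bookkeeping] [folklore] -/
theorem cone_exponents_nu {A B ν f : Fin 4} (hAB : A ≠ B) (hAν : A ≠ ν) (hAf : A ≠ f) (hBν : B ≠ ν)
    (hBf : B ≠ f) (hνf : ν ≠ f) {s : State K} (ho : ordZero s.F = 6)
    (hr : ∀ d ∈ s.F.support, s.r ≤ d)
    (hrABν : s.r = Finsupp.single A 1 + Finsupp.single B 1 + Finsupp.single ν 1)
    (hres : ∀ μ ∈ (resForm s).support, μ A = 0 ∧ μ B = 0 ∧ μ f = 0) :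
    ∀ D ∈ s.F.support, D.degree = 6 → D ν = 4 := by
  intro D hD hdeg
  obtain ⟨hA, hf⟩ := cone_exponents_first hAB hAν hAf hBν hBf hνf ho hr hrABν
    (fun μ hμ => ⟨(hres μ hμ).1, (hres μ hμ).2.2⟩) D hD hdeg
  have hrBAν : s.r = Finsupp.single B 1 + Finsupp.single A 1 + Finsupp.single ν 1 := by
    rw [hrABν, add_comm (Finsupp.single A 1)]
  obtain ⟨hB, -⟩ := cone_exponents_first hAB.symm hBν hBf hAν hAf hνf ho hr hrBAν
    (fun μ hμ => ⟨(hres μ hμ).2.1, (hres μ hμ).2.2⟩) D hD hdeg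
  rw [degree_eq_four_apply hAB hAν hAf hBν hBf hνf] at hdeg
  omega

/-- **(iii)/(iv), cone dress.**  At `s₀`: boundary `e_A + e_B + e_ν`, order `6`, cone `a₀ (Σ ℓ₀ᵢ xᵢ)^3` with
`ℓ₀ A = 0` (direction `ℓ₀ f + τ ℓ₀ A = 0` of the rotation in the L-sector), `ℓ₀ f = 0` (L-sector) and `ℓ₀ B = 0`
(propagated back from `ℓ₁ B = 0`); rotation chart `f`, translation `τ e_A`; at `s₁`: boundary `e_f + e_B + e_ν`
(`f` exceptional of weight `1`, `A` free), order `6`, cone `a₁ (Σ ℓ₁ᵢ xᵢ)^3` with `ℓ₁ A = 0` (propagated L-sector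
for the new free letter) and `ℓ₁ B = 0` (direction of the second step: slot `B` along `A` in (iii), rotation chart
`A` losing `B` in (iv)); then the chart `κ` with translation `γ e_t`, `{κ, t} ∩ {f, ν} = ∅`, ends at a
non-isolated state. [OURS] [folklore] -/
theorem not_isIsolated_after_rotation_step_of_forms {A B ν f κ t : Fin 4} (hAB : A ≠ B) (hAν : A ≠ ν)
    (hAf : A ≠ f) (hBν : B ≠ ν) (hBf : B ≠ f) (hνf : ν ≠ f) (hκt : κ ≠ t) (hκf : κ ≠ f) (hκν : κ ≠ ν)
    (htf : t ≠ f) (htν : t ≠ ν) (s₀ : State K) (τ γ : K)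
    (ho₀ : ordZero s₀.F = 6) (hr₀ : ∀ d ∈ s₀.F.support, s₀.r ≤ d)
    (hrABν₀ : s₀.r = Finsupp.single A 1 + Finsupp.single B 1 + Finsupp.single ν 1)
    {a₀ : K} {ℓ₀ : Fin 4 → K} (hform₀ : resForm s₀ = C a₀ * (∑ i, C (ℓ₀ i) * X i) ^ 3)
    (hℓ₀A : ℓ₀ A = 0) (hℓ₀B : ℓ₀ B = 0) (hℓ₀f : ℓ₀ f = 0)
    {s₁ : State K} (hs₁ : s₁ = CentreBlowup.step 5 Finset.univ f (Pi.single A τ) s₀)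
    (ho₁ : ordZero s₁.F = 6) (hr₁ : ∀ d ∈ s₁.F.support, s₁.r ≤ d)
    (hrfBν₁ : s₁.r = Finsupp.single f 1 + Finsupp.single B 1 + Finsupp.single ν 1)
    {a₁ : K} {ℓ₁ : Fin 4 → K} (hform₁ : resForm s₁ = C a₁ * (∑ i, C (ℓ₁ i) * X i) ^ 3)
    (hℓ₁A : ℓ₁ A = 0) (hℓ₁B : ℓ₁ B = 0)
    {s₂ : State K} (hs₂ : s₂ = CentreBlowup.step 5 Finset.univ κ (Pi.single t γ) s₁) :
    ¬ IsIsolated 5 s₂.F := by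
  have hq₀ : ((5 : ℕ) : ℕ∞) ≤ ordAlong Finset.univ s₀.F := by
    refine le_ordAlong_iff.mpr fun d hd => ?_
    rw [degIn_univ]
    exact_mod_cast le_trans (by norm_num) (le_degree_of_mem_support_of_ordZero ho₀ hd)
  have hq₁ : ((5 : ℕ) : ℕ∞) ≤ ordAlong Finset.univ s₁.F := by
    refine le_ordAlong_iff.mpr fun d hd => ?_
    rw [degIn_univ]
    exact_mod_cast le_trans (by norm_num) (le_degree_of_mem_support_of_ordZero ho₁ hd)
  have hq := triple_apply hAB hAν hAf hBν hBf hνf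
  refine not_isIsolated_after_rotation_step hAB hAν hAf hBf hνf hκt hκf hκν htf htν s₀ τ γ hq₀
    (fun D hD => le_degree_of_mem_support_of_ordZero ho₀ hD) (fun D hD => ?_)
    (cone_exponents_nu hAB hAν hAf hBν hBf hνf ho₀ hr₀ hrABν₀ fun μ hμ =>
      ⟨apply_eq_zero_of_mem_support_C_mul_linearForm_pow hℓ₀A (hform₀ ▸ hμ),
        apply_eq_zero_of_mem_support_C_mul_linearForm_pow hℓ₀B (hform₀ ▸ hμ),
        apply_eq_zero_of_mem_support_C_mul_linearForm_pow hℓ₀f (hform₀ ▸ hμ)⟩)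
    hs₁ hq₁ (fun E hE => le_degree_of_mem_support_of_ordZero ho₁ hE) (fun E hE hdeg => ?_) hs₂
  · have h := hr₀ D hD
    have hB := h B
    have hν := h ν
    rw [hrABν₀, hq.2.1] at hB
    rw [hrABν₀, hq.2.2.1] at hν
    exact ⟨hB, hν⟩
  · have h := cone_exponents_second (A := f) (B := B) (ν := ν) (f := A) hBf.symm hνf.symm hAf.symm hBν hAB.symm
      hAν.symm ho₁ hr₁ hrfBν₁ (fun μ hμ =>
      ⟨apply_eq_zero_of_mem_support_C_mul_linearForm_pow hℓ₁B (hform₁ ▸ hμ),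
        apply_eq_zero_of_mem_support_C_mul_linearForm_pow hℓ₁A (hform₁ ▸ hμ)⟩) E hE hdeg
    omega

end ResCone

end Summit.ResolutionOfSingularities.ResolutionOfSingularities.Theorems.PIDim4
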